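import Mathlib
import HarnessLib
import Summits.PneNP.PneNP.Theses.CnfIdealGenLength
import Literature.Computability.AlgebraicComplexity.MignonRessayreBound

/-!
# Route `CnfIdealGenLength` — rank counting: `RankDefectRepresentations → GenLengthSuperpoly`

The SUFFICIENT door of the crux `GenLengthSuperpoly` (stmt-PneNP-18879) through the support item
`RankDefectRepresentations` (stmt-PneNP-18923), kernel-checked with no stub left: if a matrix tuple
`M : Fin n → K^{d×d}` (any field `K` of characteristic `0`) sends every Boolean/commutator axiom to a matrix
of rank `≤ t`, then a two-sided representation `clauseProduct ℚ φ = ∑_{ρ<r} u_ρ g_ρ v_ρ` forces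
`rank P_φ(M) ≤ r · t` — evaluate the representation at `M` (`MonoidAlgebra.lift` over `ℚ`; the value of the
clause product does not depend on the coefficient ring, `lift_clauseProduct`), `rank (u g v)(M) ≤ rank g(M)`,
and rank is subadditive. So `rank P_φ(M) > n^c · t` eventually (the item) excludes `HasBoundedRepr ℚ (n^c) (n^c)`
eventually (the crux). This discharges the birth skeleton's `stub_rankCount` and `stub_reprBaseChange` at once
(no base change is needed: `ℚ`-polynomials are evaluated in the `ℚ`-algebra `K^{d×d}` directly).
-/

set_option linter.dupNamespace false -- `Summit.PneNP.PneNP.…`: summit = sub-problem name (D-0017)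

namespace Summit.PneNP.PneNP.Theorems.CnfIdealGenLength

open Filter
open Literature.Computability.Complexity
open Literature.Computability.MetaComplexity
open Literature.Computability.MetaComplexity.NCIPS

/-- Evaluating the clause product under `MonoidAlgebra.lift R A _ f`: the result is the ordered product
`∏_κ (1 - ∏_{l ∈ κ} (1 - f x_i | f x_i))` computed in `A`, and in particular does not depend on the
coefficient ring `R`. [cite: LiTzameretWang2018, Def. 1.3 with Def. 1.6] -/
theorem lift_clauseProduct {R A : Type*} [CommRing R] [Ring A] [Algebra R A] {ν : Type*}
    (f : FreeMonoid ν →* A) (φ : CNF ν) :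
    MonoidAlgebra.lift R A (FreeMonoid ν) f (clauseProduct R φ) =
      (φ.map fun κ => 1 - (κ.map fun l =>
        if l.2 then 1 - f (FreeMonoid.of l.1) else f (FreeMonoid.of l.1)).prod).prod := by
  induction φ with
  | nil => simp
  | cons κ φ ih =>
    rw [clauseProduct_cons, map_mul, map_sub, map_one, ih, List.map_cons, List.prod_cons]
    congr 2
    induction κ with
    | nil => simp
    | cons l κ ihκ =>
      rw [clauseWord_cons, map_mul, ihκ, List.map_cons, List.prod_cons]
      congr 1
      unfold litWord X
      split_ifs <;> simp

/-- **Rank counting.** If every Boolean/commutator axiom over `K` evaluates under `M` to rank `≤ t` and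
`clauseProduct ℚ φ` has a two-sided representation with `r` terms (any cofactor degrees), then the clause
product evaluates to rank `≤ r · t`. [folklore] -/
theorem rank_clauseProduct_le_of_hasBoundedRepr {n : ℕ} {K : Type} [Field K] [CharZero K] {d t E r : ℕ}
    (M : Fin n → Matrix (Fin d) (Fin d) K)
    (hax : ∀ g : MonoidAlgebra K (FreeMonoid (Fin n)), IsAxiom g →
      (MonoidAlgebra.lift K (Matrix (Fin d) (Fin d) K) (FreeMonoid (Fin n)) (FreeMonoid.lift M) g).rank ≤ t)
    {φ : CNF (Fin n)} (h : HasBoundedRepr ℚ E r φ) :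
    (MonoidAlgebra.lift K (Matrix (Fin d) (Fin d) K) (FreeMonoid (Fin n)) (FreeMonoid.lift M)
      (clauseProduct K φ)).rank ≤ r * t := by
  obtain ⟨u, g, v, huv, hsum⟩ := h
  set evQ := MonoidAlgebra.lift ℚ (Matrix (Fin d) (Fin d) K) (FreeMonoid (Fin n)) (FreeMonoid.lift M)
    with hevQ
  set evK := MonoidAlgebra.lift K (Matrix (Fin d) (Fin d) K) (FreeMonoid (Fin n)) (FreeMonoid.lift M)
    with hevK
  have hPQ : evK (clauseProduct K φ) = evQ (clauseProduct ℚ φ) := by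
    rw [lift_clauseProduct, lift_clauseProduct]
  have hX : ∀ i, evQ (X ℚ i) = evK (X K i) := by
    intro i
    simp [hevQ, hevK, X]
  have hg : ∀ ρ, (evQ (g ρ)).rank ≤ t := by
    intro ρ
    rcases (huv ρ).1 with ⟨i, hi⟩ | ⟨i, j, hij, hi⟩
    · have h1 := hax (X K i * X K i - X K i) (Or.inl ⟨i, rfl⟩)
      rwa [map_sub, map_mul, ← hX, ← map_mul, ← map_sub, ← hi] at h1
    · have h1 := hax (X K i * X K j - X K j * X K i) (Or.inr ⟨i, j, hij, rfl⟩)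
      rwa [map_sub, map_mul, map_mul, ← hX, ← hX, ← map_mul, ← map_mul, ← map_sub, ← hi] at h1
  rw [hPQ, ← hsum, map_sum]
  refine (Literature.Computability.AlgebraicComplexity.rank_sum_le _ _).trans ?_
  calc ∑ ρ, (evQ (u ρ * g ρ * v ρ)).rank ≤ ∑ _ρ : Fin r, t := Finset.sum_le_sum fun ρ _ => by
          rw [map_mul, map_mul]
          exact (Matrix.rank_mul_le_left _ _).trans ((Matrix.rank_mul_le_right _ _).trans (hg ρ))
    _ = r * t := by simp

/-- **`RankDefectRepresentations → GenLengthSuperpoly`** (the sufficient door of the crux, by name):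
rank-defect representations with `rank P_φ(M) > n^c · t` eventually exclude two-sided representations with
`n^c` terms eventually, for the same family and the same `c`. [folklore] -/
theorem genLengthSuperpoly_of_rankDefectRepresentations :
    Summit.PneNP.PneNP.Theses.CnfIdealGenLength.RankDefectRepresentations →
      Summit.PneNP.PneNP.Theses.CnfIdealGenLength.GenLengthSuperpoly := by
  rintro ⟨p, φ, hφ, h⟩
  refine ⟨p, φ, hφ, fun c => ?_⟩
  filter_upwards [h c] with n hn hrepr
  obtain ⟨K, _, _, d, t, M, hax, hrank⟩ := hn
  have := rank_clauseProduct_le_of_hasBoundedRepr M hax hrepr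
  omega

end Summit.PneNP.PneNP.Theorems.CnfIdealGenLength
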